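import Summits.AnomalousDissipation.AnomalousDissipation.Theorems.TwodBoundedEnergyZeroMomentum.Negative.EnergyFloor

/-!
# The energy floor of the crux `TwoAndHalfD.TwodBoundedEnergyZeroMomentum`, sharpened to the strain of the force
(negative-side support, cdisprove seat `refuter-cdisprove-stmt-AnomalousDissipation-10786-g2-0`, gen 2;
Lean target proposed by crux-ideate gen 2, `Cruxes/…/NegativeNotesIdeator1g2.md` §BN1)

`energy_floor` (gen 1, `Negative/EnergyFloor.lean`) bounds the Reynolds-stress pairing
`∫⟪u,(u·∇)g⟫` by `D∫‖u‖²` with `D = ‖∑ᵢ‖∂ᵢg‖‖_∞`.  Only a ONE-SIDED bound is needed: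
`⟪w, ∇g(x)w⟫ = wᵀ sym∇g(x) w ≥ -M‖w‖²` with `M = sup_x` (top eigenvalue of `-sym∇g(x)`) — for a
divergence-free planar force `sym∇g` is trace free, so `M = ‖sym∇g‖_∞` (largest strain rate).  Hence

* `energy_floor_sym` — `‖g‖₂² ≤ M⟨‖u‖²⟩ + (νK/2)(1 + ⟨‖u‖²⟩)` for every zero-momentum global
  Leray–Hopf solution; `witness_ceiling_ge_floor_sym` — along any witness family `‖g‖₂² ≤ M·E`, i.e.
  `E ≥ ‖g‖₂²/‖sym∇g‖_∞` (Kolmogorov `g = sin(k_f x₁)e₀` on the unit torus, `‖g‖₂² = ½`: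
  `M = πk_f` vs `D = 2πk_f`, floor `⟨‖u‖²⟩ ≥ 1/(2πk_f)`).

The global constant `μ_max(g) = sup spec(v ↦ -P(sym∇g)v on L²_σ) ≤ M` of the ideator's note would be
sharper still; the pointwise `M` is what the weak formulation gives without spectral theory.
No new definitions.
-/

noncomputable section

open MeasureTheory Set Filter Topology UnitAddTorus
open scoped ENNReal NNReal InnerProductSpace RealInnerProductSpace

namespace Summit.AnomalousDissipation.AnomalousDissipation.Theorems.TwodBoundedEnergyZeroMomentum.Negative

open Literature.Analysis.FunctionSpaces Literature.Analysis.FunctionSpaces.Torus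
open Literature.Analysis.FluidPDE Literature.Analysis.FluidPDE.Torus

variable {ν : ℝ} {g u₀ : (UnitAddTorus (Fin 2)) → (EuclideanSpace ℝ (Fin 2))}
  {u : ℝ → (UnitAddTorus (Fin 2)) → (EuclideanSpace ℝ (Fin 2))}

set_option maxHeartbeats 400000 in
/-- **ENERGY FLOOR, sharpened to the strain of the force (asked for by crux-ideate gen 2, NegativeNotesIdeator1g2.md §BN1).** Let `g` be smooth, divergence free and mean
zero, `ν > 0`, `u₀ ∈ L²` with zero mean, and `u` a global Leray–Hopf solution forced by `g`. If
`-M‖w‖² ≤ ⟪w, ∇g(x) w⟫` for all `x, w` (i.e. `M ≥ sup_x` top eigenvalue of `-sym∇g(x)` = `‖sym∇g‖_∞` for a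
divergence-free planar `g`; always `M ≤ ∑ᵢ‖∂ᵢg‖_∞`, the constant `D` of `energy_floor`) and `‖Δg‖ ≤ K`
pointwise, then `‖g‖₂² ≤ M ⟨‖u‖²⟩ + (νK/2)(1 + ⟨‖u‖²⟩)` (e.g. Kolmogorov `g = sin(k_f x₁)e₀`: `M = k_f/2`,
`D = k_f`).
Proof: test the weak formulation with `g` itself (`Torus.IsLerayHopfOn.integral_inner_eq_add_setIntegral`):
`⟨u(T),g⟩ - ⟨u₀,g⟩ = ∫₀ᵀ (⟨u,(u·∇)g⟩ + ν⟨u,Δg⟩ + ‖g‖₂²)`, bound the convective pairing BELOW by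
`-M‖u‖₂²` (`⟪u,(u·∇)g⟫ = uᵀ(∇g)u ≥ -M|u|²` pointwise) and the viscous one by `K‖u‖₁ ≤ ½K(1 + ‖u‖₂²)`, divide by `T` (the boundary terms are
`O(√T)` by `integral_norm_sq_le_affine`) and let `T → ∞` along the `limsup`.
CONSEQUENCE FOR THE CRUX (tightness of the sought constant): along any witness family,
`E ≥ ⟨‖v_j‖²⟩ ≥ (‖g‖₂² - ν_jK/2)/(M + ν_jK/2) → ‖g‖₂²/M`: the bound `E` can never be smaller than
`‖g‖₂²/‖sym∇g‖_∞`, and the flow cannot decorrelate from the force by becoming small — the balance laws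
pin the witness energy between an `O(1)` floor and the sought `O(1)` ceiling, with no `ν⁻¹` growth
(which is why they cannot kill the crux). [folklore] -/
theorem energy_floor_sym (hν : 0 < ν) (hg : IsSmooth g) (hgd : IsDivFree g) (hg0 : HasZeroMean g)
    (hu₀ : MemLp u₀ 2 volume) (h0 : HasZeroMean u₀)
    (hu : Torus.IsGlobalLerayHopf ν (fun _ => g) u₀ u)
    {M : ℝ} (hM0 : 0 ≤ M)
    (hM : ∀ (x : UnitAddTorus (Fin 2)) (w : EuclideanSpace ℝ (Fin 2)), -(M * ‖w‖ ^ 2) ≤ ⟪w, Torus.fderiv g x w⟫)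
    {K : ℝ} (hK0 : 0 ≤ K) (hK : ∀ x, ‖laplacian g x‖ ≤ K) :
    ∫ x, ‖g x‖ ^ 2 ≤ M * meanEnergy u + ν * K / 2 * (1 + meanEnergy u) := by
  set E : ℝ → ℝ := fun τ => ∫ x, ‖u τ x‖ ^ 2 with hEdef
  set A2 : ℝ := ∫ x, ‖g x‖ ^ 2 with hA2
  set Φ : ℝ → ℝ := fun s => ∫ x, ⟪u s x, g x⟫ with hΦ
  set B₀ : ℝ := |∫ x, ⟪u₀ x, g x⟫| with hB₀
  set c : ℝ := M + ν * K / 2 with hc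
  have hc0 : 0 ≤ c := by positivity
  have hA2_0 : 0 ≤ A2 := integral_nonneg fun _ => sq_nonneg _
  have hE0 : ∀ τ, 0 ≤ E τ := fun τ => integral_nonneg fun _ => sq_nonneg _
  have hB₀0 : 0 ≤ B₀ := abs_nonneg _
  have hfm : ∀ T : ℝ, AEStronglyMeasurable (stLift fun _ : ℝ => g)
      (volume.restrict (Ioo 0 T ×ˢ univ)) := fun T => aestronglyMeasurable_stLift_steady hg.continuous _
  have hf₂ : ∀ T : ℝ, ∫⁻ _ in Ioo (0 : ℝ) T, ∫⁻ x, ‖g x‖ₑ ^ 2 < ⊤ := fun T =>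
    lintegral_Ioo_lintegral_enorm_sq_steady_lt_top (hg.memLp 2) T
  -- STEP 1: the Cesàro inequality `A2·T ≤ |Φ T| + B₀ + (νK/2) T + c ∫₀ᵀ E`
  have step1 : ∀ T, 0 < T → A2 * T ≤ |Φ T| + B₀ + ν * K / 2 * T + c * ∫ s in Ioc 0 T, E s := by
    intro T hT
    set flux : ℝ → ℝ := fun s =>
      ∫ x, (⟪u s x, convect (u s) g x⟫ + ν * ⟪u s x, laplacian g x⟫ + ⟪g x, g x⟫) with hflux
    have hid : Φ T = (∫ x, ⟪u₀ x, g x⟫) + ∫ s in Ioc 0 T, flux s :=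
      (hu T hT).integral_inner_eq_add_setIntegral hT (hfm T) (hf₂ T) hg hgd ⟨hT, le_rfl⟩
    have hlow : ∀ s ∈ Ioc (0 : ℝ) T, (A2 - ν * K / 2) - c * E s ≤ flux s := by
      intro s hs
      have hmem : MemLp (u s) 2 volume := hu.memLp_two hs.1.le
      have i1 := integrable_inner_convect_self hmem hg
      have i2 : Integrable (fun x => ⟪u s x, laplacian g x⟫) volume :=
        integrable_inner_of_continuous (hmem.integrable one_le_two) hg.laplacian.continuous
      have i3 : Integrable (fun x => ⟪g x, g x⟫) volume :=
        integrable_inner_of_continuous hg.integrable hg.continuous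
      have i12 : Integrable (fun x => ⟪u s x, convect (u s) g x⟫ + ν * ⟪u s x, laplacian g x⟫)
          volume := i1.add (i2.const_mul ν)
      have hsplit : flux s = (∫ x, ⟪u s x, convect (u s) g x⟫) +
          ν * (∫ x, ⟪u s x, laplacian g x⟫) + A2 := by
        simp only [hflux]
        rw [integral_add i12 i3, integral_add i1 (i2.const_mul ν), integral_const_mul]
        congr 1
        simp only [hA2]
        exact integral_congr_ae (ae_of_all _ fun x => real_inner_self_eq_norm_sq _)
      have b1 : -(M * E s) ≤ ∫ x, ⟪u s x, convect (u s) g x⟫ := by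
        have hpt : ∀ x, -(M * ‖u s x‖ ^ 2) ≤ ⟪u s x, convect (u s) g x⟫ := fun x => hM x (u s x)
        have iM : Integrable (fun x => -(M * ‖u s x‖ ^ 2)) volume :=
          ((hmem.integrable_norm_pow two_ne_zero).const_mul M).neg
        have h := integral_mono iM i1 hpt
        rw [integral_neg, integral_const_mul] at h
        exact h
      have b2 : |∫ x, ⟪u s x, laplacian g x⟫| ≤ K * (2⁻¹ * (1 + E s)) :=
        (abs_integral_inner_le_of_norm_le (hmem.integrable one_le_two) hK).trans
          (mul_le_mul_of_nonneg_left (integral_norm_le_of_memLp_two hmem) hK0)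
      rw [hsplit]
      have hb2 := neg_abs_le (∫ x, ⟪u s x, laplacian g x⟫)
      have hb2' : -(K * (2⁻¹ * (1 + E s))) ≤ ∫ x, ⟪u s x, laplacian g x⟫ := by linarith
      have hb3 : ν * -(K * (2⁻¹ * (1 + E s))) ≤ ν * ∫ x, ⟪u s x, laplacian g x⟫ :=
        mul_le_mul_of_nonneg_left hb2' hν.le
      simp only [hc]
      linarith
    have hfluxInt : IntegrableOn flux (Ioc 0 T) :=
      (integrableOn_Ioc_iff_integrableOn_Ioo).2 ((hu T hT).integrableOn_flux (hfm T) (hf₂ T) hg)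
    have hEInt : IntegrableOn E (Ioc 0 T) := hu.integrableOn_integral_norm_sq hT
    have hconstInt : IntegrableOn (fun _ : ℝ => A2 - ν * K / 2) (Ioc 0 T) :=
      integrableOn_const (hs := measure_Ioc_lt_top.ne)
    have hlowInt : IntegrableOn (fun s => (A2 - ν * K / 2) - c * E s) (Ioc 0 T) :=
      hconstInt.sub (hEInt.const_mul c)
    have hmono := setIntegral_mono_on hlowInt hfluxInt measurableSet_Ioc hlow
    have hcomp : ∫ s in Ioc 0 T, ((A2 - ν * K / 2) - c * E s) =
        (A2 - ν * K / 2) * T - c * ∫ s in Ioc 0 T, E s := by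
      rw [integral_sub hconstInt (hEInt.const_mul c), setIntegral_const, integral_const_mul,
        Real.volume_real_Ioc_of_le hT.le, sub_zero, smul_eq_mul, mul_comm]
    have hΦT := le_abs_self (Φ T)
    have hΦ0 := neg_abs_le (∫ x, ⟪u₀ x, g x⟫)
    rw [hcomp] at hmono
    simp only [hB₀]
    linarith
  -- STEP 2: the boundary terms are `O(√T)`
  obtain ⟨a, b, ha, hb, hEab⟩ : ∃ a b : ℝ, 0 ≤ a ∧ 0 ≤ b ∧ ∀ t, 0 < t → E t ≤ a + b * t := by
    refine ⟨2 * kineticEnergy u₀ + kineticEnergy u₀ / (2 * Real.pi ^ 2 * ν),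
      A2 + A2 / (16 * Real.pi ^ 4 * ν ^ 2), ?_, ?_, fun t ht =>
      integral_norm_sq_le_affine hν hg hg0 hu₀ h0 hu ht⟩
    · have := kineticEnergy_nonneg u₀
      positivity
    · positivity
  set R : ℝ := Real.sqrt (a + b) * Real.sqrt A2 + B₀ with hR
  have hR0 : 0 ≤ R := by positivity
  have step2 : ∀ T, 1 ≤ T → |Φ T| + B₀ ≤ R * Real.sqrt T := by
    intro T hT
    have hT0 : 0 < T := one_pos.trans_le hT
    have h1 : |Φ T| ≤ Real.sqrt (E T) * Real.sqrt A2 :=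
      abs_integral_inner_le_sqrt_mul_sqrt (hu.memLp_two hT0.le) (hg.memLp 2)
    have h2 : E T ≤ (a + b) * T := by
      have := hEab T hT0
      nlinarith
    have h3 : Real.sqrt (E T) ≤ Real.sqrt (a + b) * Real.sqrt T := by
      rw [← Real.sqrt_mul (by positivity)]
      exact Real.sqrt_le_sqrt h2
    have h4 : 1 ≤ Real.sqrt T := by
      rw [← Real.sqrt_one]
      exact Real.sqrt_le_sqrt hT
    have h5 : B₀ ≤ B₀ * Real.sqrt T := le_mul_of_one_le_right hB₀0 h4
    have hA : 0 ≤ Real.sqrt A2 := Real.sqrt_nonneg _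
    calc |Φ T| + B₀ ≤ Real.sqrt (a + b) * Real.sqrt T * Real.sqrt A2 + B₀ * Real.sqrt T := by
          gcongr
          exact h1.trans (mul_le_mul_of_nonneg_right h3 hA)
      _ = R * Real.sqrt T := by
          simp only [hR]
          ring
  -- STEP 3: pass to the `limsup`
  set Mu : ℝ := meanEnergy u with hMu
  have hMu0 : 0 ≤ Mu := longTimeAvgSup_nonneg fun t => integral_nonneg fun _ => sq_nonneg _
  have hlimsup : limsup (timeMean E) atTop = Mu := by
    rw [hMu, meanEnergy_eq_longTimeAvgSup, longTimeAvgSup]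
  have hbdd : IsBoundedUnder (· ≤ ·) atTop (timeMean E) :=
    ⟨_, (eventually_ge_atTop (1 : ℝ)).mono fun T hT => hu.timeMean_norm_sq_le hν hg hg0 hT⟩
  by_contra hcon
  push Not at hcon
  set δ : ℝ := A2 - (M * Mu + ν * K / 2 * (1 + Mu)) with hδ
  have hδ0 : 0 < δ := by
    simp only [hδ]
    linarith
  set ε : ℝ := δ / (2 * (1 + c)) with hε
  have hε0 : 0 < ε := by positivity
  have hεc : ε * (2 * (1 + c)) = δ := div_mul_cancel₀ δ (by positivity)
  have hev1 : ∀ᶠ T in atTop, timeMean E T < Mu + ε :=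
    eventually_lt_of_limsup_lt (by rw [hlimsup]; linarith) hbdd
  have hev2 : ∀ᶠ T in atTop, max 1 ((R / ε) ^ 2) ≤ T := eventually_ge_atTop _
  obtain ⟨T, hT1, hT2⟩ := (hev1.and hev2).exists
  have hT1' : 1 ≤ T := (le_max_left _ _).trans hT2
  have hT0 : 0 < T := one_pos.trans_le hT1'
  -- boundary ≤ ε T
  have hsqrtT : R / ε ≤ Real.sqrt T := by
    have h := Real.sqrt_le_sqrt ((le_max_right _ _).trans hT2)
    rwa [Real.sqrt_sq (by positivity)] at h
  have hbdry : |Φ T| + B₀ ≤ ε * T := by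
    refine (step2 T hT1').trans ?_
    have h1 : R ≤ ε * Real.sqrt T := by
      rw [div_le_iff₀ hε0] at hsqrtT
      linarith
    have h2 : R * Real.sqrt T ≤ ε * Real.sqrt T * Real.sqrt T :=
      mul_le_mul_of_nonneg_right h1 (Real.sqrt_nonneg _)
    rwa [mul_assoc, Real.mul_self_sqrt hT0.le] at h2
  -- the mean: `∫₀ᵀ E = T · timeMean E T`
  have hmean : ∫ s in Ioc 0 T, E s = T * timeMean E T := by
    rw [timeMean, intervalIntegral.integral_of_le hT0.le, ← mul_assoc, mul_inv_cancel₀ hT0.ne', one_mul]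
  have hI : c * ∫ s in Ioc 0 T, E s ≤ c * (T * (Mu + ε)) := by
    rw [hmean]
    exact mul_le_mul_of_nonneg_left (mul_le_mul_of_nonneg_left hT1.le hT0.le) hc0
  have key := step1 T hT0
  have key2 : A2 * T ≤ (ε + ν * K / 2 + c * (Mu + ε)) * T := by nlinarith
  have key3 : A2 ≤ ε + ν * K / 2 + c * (Mu + ε) := le_of_mul_le_mul_right key2 hT0
  have : δ ≤ ε * (1 + c) := by
    simp only [hδ, hc] at key3 ⊢
    nlinarith
  nlinarith

/-- **The ceiling is at least the (sharpened) floor.** In the notation of the crux: if `g` (smooth,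
divergence free, mean zero, `-M‖w‖² ≤ ⟪w,∇g(x)w⟫`, `‖Δg‖ ≤ K` pointwise) admits zero-momentum global
Leray–Hopf families along `ν_j → 0⁺` with `⟨‖v_j‖²⟩ ≤ E` for all `j`, then `‖g‖₂² ≤ M·E`.
So the constant of any witness of the crux obeys `E ≥ ‖g‖₂²/‖sym∇g‖_∞`: bounded-energy witnesses
live at energies comparable to the sweeping scale `‖g‖₂/‖∇g‖_∞` or above, never below (and in
particular the witness flow cannot decorrelate from `g` by being small). [folklore] -/
theorem witness_ceiling_ge_floor_sym (hg : IsSmooth g) (hgd : IsDivFree g) (hg0 : HasZeroMean g)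
    {M : ℝ} (hM0 : 0 ≤ M)
    (hM : ∀ (x : UnitAddTorus (Fin 2)) (w : EuclideanSpace ℝ (Fin 2)), -(M * ‖w‖ ^ 2) ≤ ⟪w, Torus.fderiv g x w⟫)
    {K : ℝ} (hK0 : 0 ≤ K) (hK : ∀ x, ‖laplacian g x‖ ≤ K) {νs : ℕ → ℝ} {v₀ : ℕ → (UnitAddTorus (Fin 2)) → (EuclideanSpace ℝ (Fin 2))}
    {v : ℕ → ℝ → (UnitAddTorus (Fin 2)) → (EuclideanSpace ℝ (Fin 2))} (hν : ∀ j, 0 < νs j) (hν0 : Tendsto νs atTop (𝓝 0))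
    (hdata : ∀ j, MemLp (v₀ j) 2 volume ∧ HasZeroMean (v₀ j))
    (hLH : ∀ j, Torus.IsGlobalLerayHopf (νs j) (fun _ => g) (v₀ j) (v j)) {E : ℝ}
    (hE : ∀ j, meanEnergy (v j) ≤ E) :
    ∫ x, ‖g x‖ ^ 2 ≤ M * E := by
  have hME : ∀ j, 0 ≤ meanEnergy (v j) := fun j =>
    longTimeAvgSup_nonneg fun t => integral_nonneg fun _ => sq_nonneg _
  have hE0 : 0 ≤ E := (hME 0).trans (hE 0)
  have hj : ∀ j, ∫ x, ‖g x‖ ^ 2 ≤ M * E + νs j * (K / 2 * (1 + E)) := fun j => by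
    have h := energy_floor_sym (hν j) hg hgd hg0 (hdata j).1 (hdata j).2 (hLH j) hM0 hM hK0 hK
    have h1 : M * meanEnergy (v j) ≤ M * E := mul_le_mul_of_nonneg_left (hE j) hM0
    have h2 : νs j * K / 2 * (1 + meanEnergy (v j)) ≤ νs j * (K / 2 * (1 + E)) := by
      have h3 : K / 2 * (1 + meanEnergy (v j)) ≤ K / 2 * (1 + E) :=
        mul_le_mul_of_nonneg_left (by linarith [hE j]) (by positivity)
      have h4 := mul_le_mul_of_nonneg_left h3 (hν j).le
      linarith [h4]
    linarith
  have hlim : Tendsto (fun j => M * E + νs j * (K / 2 * (1 + E))) atTop (𝓝 (M * E)) := by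
    have := (hν0.mul_const (K / 2 * (1 + E))).const_add (M * E)
    simpa using this
  exact ge_of_tendsto' hlim hj

end Summit.AnomalousDissipation.AnomalousDissipation.Theorems.TwodBoundedEnergyZeroMomentum.Negative

end
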